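import Summits.NavierStokesRegularity.NavierStokesRegularity.Theses.ScaledTopAlignment
import Summits.NavierStokesRegularity.NavierStokesRegularity.Theorems.ScaledTopAlignmentBulkRung
import Summits.NavierStokesRegularity.NavierStokesRegularity.Theorems.ScaledTopAlignmentRegularCase
import HarnessLib

/-!
# Route `ScaledTopAlignment`: the REGULAR CASE of the most-times door W3ᵐᵗ = `AprioriMostTimesBulkAlignment`
# (stmt-NavierStokesRegularity-19551), BY NAME — independent of `ScaledTopAlignmentMostTimesRung`

Planner p3 g3 turnkey (separate file so that it does not collide with p437738 = Theorems/ScaledTopAlignmentMostTimesRung.lean).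
* `mostTimesBulkAlignedAt_of_hasSmoothExtensionPast` — a classical Leray–Hopf solution on `[0,T)` that extends classically past `T`
  satisfies W3ᵐᵗ's conclusion at that solution (through the tree's `scaledTopAlignmentAt_of_hasSmoothExtensionPast` = W3-at-u and
  `scaledBulkAligned_of_scaledTopAligned`; then λ₀ = ½, R₀ = 1, θ = ½, E = ∅);
* `aprioriMostTimesBulkAlignment_iff_singular` — hence W3ᵐᵗ is equivalent to W3ᵐᵗ restricted to solutions that do NOT extend past `T`
  (first blow-up times; with the route's residual NoTypeII these are Type-I blow-up times).
Equivalences/special cases of an OPEN statement; nothing here proves W3ᵐᵗ. WHAT THIS IS NOT: not NS regularity. [folklore]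
-/

noncomputable section
set_option linter.dupNamespace false
open MeasureTheory Set Literature.Analysis.FluidPDE

namespace Summit.NavierStokesRegularity.NavierStokesRegularity.Theorems

/-- **Regular case of W3ᵐᵗ at one solution**: classical extension past `T` ⇒ the most-times window-bulk conclusion
(λ₀ = ½, R₀ = 1, θ = ½, `E = ∅`). [folklore] -/
theorem mostTimesBulkAlignedAt_of_hasSmoothExtensionPast {ν T : ℝ} (hν : 0 < ν) (hT : 0 < T)
    {u : ℝ → EuclideanSpace ℝ (Fin 3) → EuclideanSpace ℝ (Fin 3)}
    {p : ℝ → EuclideanSpace ℝ (Fin 3) → ℝ}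
    (hcl : IsClassicalNSSolutionOn (Ico 0 T) ν 0 u p) (hLH : IsLerayHopfOn T ν 0 (u 0) u)
    (hdec : HasRapidSpatialDecay (u 0)) (hext : HasSmoothExtensionPast ν 0 u T) :
    ∃ lam0 : ℝ, lam0 < 1 ∧ ∃ R0 : ℝ, 0 < R0 ∧ ∃ θ : ℝ, θ < 1 ∧ ∀ κ : ℝ, 0 < κ → ∀ ε : ℝ, 0 < ε →
      ∀ δ : ℝ, 0 < δ → ∃ M : ℝ, 0 < M ∧ ∃ E : Set ℝ,
        (∃ h0 : ℝ, 0 < h0 ∧ ∀ h : ℝ, 0 < h → h < h0 →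
          volume (E ∩ Set.Ioo (T - h) T) ≤ ENNReal.ofReal (θ * h)) ∧
        ∀ t ∈ Set.Ico 0 T, t ∉ E → ∀ x : EuclideanSpace ℝ (Fin 3), M ≤ ‖curl (u t) x‖ →
          κ / (T - t) ≤ ‖curl (u t) x‖ →
          volume {y : EuclideanSpace ℝ (Fin 3) | lam0 * ‖curl (u t) x‖ ≤ ‖curl (u t) y‖ ∧
              ‖x - y‖ ≤ R0 * Real.sqrt (ν / ‖curl (u t) x‖) ∧
              ε < Real.sqrt (1 - (inner ℝ (‖curl (u t) x‖⁻¹ • curl (u t) x)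
                (‖curl (u t) y‖⁻¹ • curl (u t) y)) ^ 2)}
            ≤ ENNReal.ofReal (δ * Real.sqrt (ν / ‖curl (u t) x‖) ^ 3) := by
  have hb := scaledBulkAligned_of_scaledTopAligned (ν := ν) (T := T) (ω := fun t => curl (u t))
    fun _lam hlam _hlam1 _R hR _ε hε =>
      scaledTopAlignmentAt_of_hasSmoothExtensionPast hν hT hcl hLH hdec hext hlam hR hε
  refine ⟨1 / 2, by norm_num, 1, one_pos, 1 / 2, by norm_num, ?_⟩
  intro κ _hκ ε hε δ hδ
  obtain ⟨M, hM, hM'⟩ := hb (1 / 2) (by norm_num) (by norm_num) 1 one_pos ε hε δ hδ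
  refine ⟨M, hM, ∅, ⟨1, one_pos, fun h _ _ => by simp⟩, ?_⟩
  intro t ht _ x hx _hrate
  simpa using hM' t ht x hx

/-- **W3ᵐᵗ ⇔ W3ᵐᵗ at first blow-up times.** [folklore] -/
theorem aprioriMostTimesBulkAlignment_iff_singular :
    Summit.NavierStokesRegularity.NavierStokesRegularity.Theses.ScaledTopAlignment.AprioriMostTimesBulkAlignment ↔
    ∀ (ν T : ℝ), 0 < ν → 0 < T → ∀ (u : ℝ → EuclideanSpace ℝ (Fin 3) → EuclideanSpace ℝ (Fin 3))
      (p : ℝ → EuclideanSpace ℝ (Fin 3) → ℝ),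
      IsClassicalNSSolutionOn (Set.Ico 0 T) ν 0 u p → IsLerayHopfOn T ν 0 (u 0) u →
      HasRapidSpatialDecay (u 0) → ¬ HasSmoothExtensionPast ν 0 u T →
      ∃ lam0 : ℝ, lam0 < 1 ∧ ∃ R0 : ℝ, 0 < R0 ∧ ∃ θ : ℝ, θ < 1 ∧ ∀ κ : ℝ, 0 < κ → ∀ ε : ℝ, 0 < ε →
        ∀ δ : ℝ, 0 < δ → ∃ M : ℝ, 0 < M ∧ ∃ E : Set ℝ,
          (∃ h0 : ℝ, 0 < h0 ∧ ∀ h : ℝ, 0 < h → h < h0 →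
            volume (E ∩ Set.Ioo (T - h) T) ≤ ENNReal.ofReal (θ * h)) ∧
          ∀ t ∈ Set.Ico 0 T, t ∉ E → ∀ x : EuclideanSpace ℝ (Fin 3), M ≤ ‖curl (u t) x‖ →
            κ / (T - t) ≤ ‖curl (u t) x‖ →
            volume {y : EuclideanSpace ℝ (Fin 3) | lam0 * ‖curl (u t) x‖ ≤ ‖curl (u t) y‖ ∧
                ‖x - y‖ ≤ R0 * Real.sqrt (ν / ‖curl (u t) x‖) ∧
                ε < Real.sqrt (1 - (inner ℝ (‖curl (u t) x‖⁻¹ • curl (u t) x)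
                  (‖curl (u t) y‖⁻¹ • curl (u t) y)) ^ 2)}
              ≤ ENNReal.ofReal (δ * Real.sqrt (ν / ‖curl (u t) x‖) ^ 3) := by
  constructor
  · intro h ν T hν hT u p hcl hLH hdec _hsing
    exact h ν T hν hT u p hcl hLH hdec
  · intro h ν T hν hT u p hcl hLH hdec
    by_cases hext : HasSmoothExtensionPast ν 0 u T
    · exact mostTimesBulkAlignedAt_of_hasSmoothExtensionPast hν hT hcl hLH hdec hext
    · exact h ν T hν hT u p hcl hLH hdec hext

end Summit.NavierStokesRegularity.NavierStokesRegularity.Theorems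

end
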